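import Summits.QuantumAdvantage.QuantumAdvantage.Theorems.LinnikCubicClassGroupsDegreeOnePrimesEscapeClassWindowDH
import Summits.QuantumAdvantage.QuantumAdvantage.Theorems.LinnikCubicClassGroupsDegreeOnePrimesEscapeFrobeniusWindowUnsmoothing
import HarnessLib

/-!
# Prime ideals of a class in short intervals with Deuring–Heilbronn, III: the `ψ_C`-form

Topic `Summits/QuantumAdvantage/QuantumAdvantage/Theorems`, cell B2b-1 (linnik-cubic), PART A (gen 19); helper
toward the crux `DegreeOnePrimesEscape` (stmt-QuantumAdvantage-11543) — the DEURING–HEILBRONN-SHARP HOHEISEL–LINNIK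
THEOREM FOR IDEAL CLASSES.  HONEST FRAMING: value = THEOREM (kernel-checked) — NOT summit progress.

`classPsi_shortInterval_dichotomy_dh`: for `n > 1` and `κ > 0` there are `δ ≤ 1/64`, `a₂`, `c` such that for
every number field `K` of degree `n`, every `x ≥ Q^{a₂}` (`Q = condQn K`), `x^{1−δ} ≤ h ≤ x` and every class `C`:
* (A) no real zero of a real class group character in `(1 − c/(log|d_K| + log 4), 1)` ⇒
  `|h_K(ψ_C(x+h) − ψ_C(x)) − h| ≤ κ h`;
* (B) `χ₁` real with the zero `β₁` there ⇒ `|h_K(ψ_C(x+h) − ψ_C(x)) − (h − χ₁(C) I)| ≤ κ·min(1,(1−β₁)log x)·h`,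
  `I = ((x+h)^{β₁} − x^{β₁})/β₁ = ∫_x^{x+h} t^{β₁−1} dt` — an error RELATIVE to the flat main term `h − I` for the
  classes with `χ₁(C) = +1` (Deuring–Heilbronn).
Unsmoothing of `classWindow_dichotomy_dh` by the two-window sandwich `window_sandwich` (gen 17) with collars
`ε = ε₀ log(1 + h/x)`, `ε₀ = e₀ Q^{−2}` (Stark's `1 − β₁ ≥ c₁Q^{−2}` keeps the collar loss relative).
References: [LagariasMontgomeryOdlyzko1979, §7]; [ThornerZaman2019, Thm. 3.1]; G. Hoheisel (1930); A. Balog, K. Ono,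
J. Number Theory 91 (2001) (fixed field, absolute error).
-/

noncomputable section

open Complex Real Finset
open scoped NumberField nonZeroDivisors

namespace Summit.QuantumAdvantage.QuantumAdvantage.Theorems.DegreeOnePrimesEscape

open Literature.NumberTheory.LFunctions Literature.NumberTheory.LFunctions.NumberField
  Literature.NumberTheory.LFunctions.EntireEF Literature.NumberTheory.LFunctions.WindowWeight
  Literature.NumberTheory.LFunctions.AbelianDensity

set_option maxHeartbeats 3200000 in
/-- **The class prime number theorem in short intervals, `ψ_C`-form, two-sided, with the exceptional character and
Deuring–Heilbronn** (see the module docstring). [cite: LagariasMontgomeryOdlyzko1979, §7] [cite: ThornerZaman2019, Theorem 3.1] -/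
theorem classPsi_shortInterval_dichotomy_dh (n : ℕ) (hn : 1 < n) {κ : ℝ} (hκ : 0 < κ) :
    ∃ δ a₂ c : ℝ, 0 < δ ∧ δ ≤ 1 / 64 ∧ 1 ≤ a₂ ∧ 0 < c ∧ c ≤ 1 / (8 * ((n : ℝ) ^ 2 + 1)) ∧
    ∀ (K : Type) [Field K] [NumberField K], Module.finrank ℚ K = n →
      ∀ x h : ℝ, ThornerZaman.condQn K ^ a₂ ≤ x → x ^ (1 - δ) ≤ h → h ≤ x →
      ((¬ ∃ (χ₁ : ClassGroup (𝓞 K) →* ℂˣ) (β₁ : ℝ), χ₁ * χ₁ = 1 ∧ classGroupLFunction K χ₁ β₁ = 0 ∧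
            1 - c / (Real.log ((NumberField.discr K).natAbs : ℝ) + Real.log 4) < β₁ ∧ β₁ < 1) →
          ∀ C : ClassGroup (𝓞 K),
            |(NumberField.classNumber K : ℝ) * (classPsi K C (x + h) - classPsi K C x) - h| ≤ κ * h) ∧
      (∀ (χ₁ : ClassGroup (𝓞 K) →* ℂˣ) (β₁ : ℝ), χ₁ * χ₁ = 1 → classGroupLFunction K χ₁ β₁ = 0 →
          1 - c / (Real.log ((NumberField.discr K).natAbs : ℝ) + Real.log 4) < β₁ → β₁ < 1 →
          ∀ C : ClassGroup (𝓞 K),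
            |(NumberField.classNumber K : ℝ) * (classPsi K C (x + h) - classPsi K C x) -
                (h - (χ₁ C : ℂ).re * (((x + h) ^ β₁ - x ^ β₁) / β₁))| ≤
              κ * min 1 ((1 - β₁) * Real.log x) * h) := by
  classical
  -- precision split: smoothed error `κ/4`, collars `24 ε₀ ≤ (κ/4) c₁ Q^{-2}`
  have hκ4 : 0 < κ / 4 := by positivity
  obtain ⟨c₁, hc₁, hc₁1, heff⟩ := Residue.one_sub_realZero_ge_condQn_rpow n hn
  set e₀ : ℝ := min (1 / 4) (κ * c₁ / 96) with he₀
  have he₀0 : 0 < e₀ := lt_min (by norm_num) (by positivity)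
  have he₀1 : e₀ ≤ 1 / 4 := min_le_left _ _
  have he₀κ : e₀ ≤ κ * c₁ / 96 := min_le_right _ _
  obtain ⟨θ, a₁, c, hθ0, hθ1, ha₁1, hc, hcn, hmain⟩ := classWindow_dichotomy_dh n hn hκ4 he₀0 he₀1
  set δ : ℝ := θ / 8 with hδ
  have hδ0 : 0 < δ := by positivity
  have hδ64 : δ ≤ 1 / 64 := by rw [hδ]; linarith
  refine ⟨δ, a₁, c, hδ0, hδ64, ha₁1, hc, hcn, ?_⟩
  intro K _ _ hKn x h hx hhx hhx'
  obtain ⟨hcaseA, hcaseB⟩ :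
      (∀ ε₀ : ℝ, e₀ * ThornerZaman.condQn K ^ (-(2 : ℝ)) ≤ ε₀ → ε₀ ≤ 1 / 4 →
        ∀ x η : ℝ, ThornerZaman.condQn K ^ a₁ ≤ x → 0 < η → η ≤ Real.log 2 →
          Real.exp (-(θ / 8) * Real.log x) ≤ 2 * η →
        ∀ lo hi : ℝ, Real.log x ≤ lo → lo < hi → hi ≤ Real.log x + η →
        (¬ ∃ (χ₁ : ClassGroup (𝓞 K) →* ℂˣ) (β₁ : ℝ), χ₁ * χ₁ = 1 ∧ classGroupLFunction K χ₁ β₁ = 0 ∧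
            1 - c / (Real.log ((NumberField.discr K).natAbs : ℝ) + Real.log 4) < β₁ ∧ β₁ < 1) →
          ∀ C : ClassGroup (𝓞 K),
          ‖(NumberField.classNumber K : ℂ) * (smoothedPsiClass K C (windowTest lo hi (ε₀ * η)) : ℂ) -
              fordLaplace (windowTest lo hi (ε₀ * η)) (-1)‖ ≤ κ / 4 * x * η) ∧
      (∀ ε₀ : ℝ, e₀ * ThornerZaman.condQn K ^ (-(2 : ℝ)) ≤ ε₀ → ε₀ ≤ 1 / 4 →
        ∀ x η : ℝ, ThornerZaman.condQn K ^ a₁ ≤ x → 0 < η → η ≤ Real.log 2 →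
          Real.exp (-(θ / 8) * Real.log x) ≤ 2 * η →
        ∀ lo hi : ℝ, Real.log x ≤ lo → lo < hi → hi ≤ Real.log x + η →
        ∀ (χ₁ : ClassGroup (𝓞 K) →* ℂˣ) (β₁ : ℝ), χ₁ * χ₁ = 1 → classGroupLFunction K χ₁ β₁ = 0 →
          1 - c / (Real.log ((NumberField.discr K).natAbs : ℝ) + Real.log 4) < β₁ → β₁ < 1 →
          ∀ C : ClassGroup (𝓞 K),
            ‖(NumberField.classNumber K : ℂ) * (smoothedPsiClass K C (windowTest lo hi (ε₀ * η)) : ℂ) -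
                fordLaplace (windowTest lo hi (ε₀ * η)) (-1) +
                (χ₁ C : ℂ) * fordLaplace (windowTest lo hi (ε₀ * η)) (-(β₁ : ℂ))‖ ≤
              κ / 4 * x * η * min 1 ((1 - β₁) * Real.log x)) :=
    ⟨fun ε₀ h1 h2 x η h3 h4 h5 h6 lo hi h7 h8 h9 ↦ (hmain K hKn ε₀ h1 h2 x η h3 h4 h5 h6 lo hi h7 h8 h9).1,
      fun ε₀ h1 h2 x η h3 h4 h5 h6 lo hi h7 h8 h9 ↦ (hmain K hKn ε₀ h1 h2 x η h3 h4 h5 h6 lo hi h7 h8 h9).2⟩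
  have hK : 1 < Module.finrank ℚ K := by rw [hKn]; exact hn
  set hKr : ℝ := (NumberField.classNumber K : ℝ) with hhKr
  have hm0 : (0 : ℝ) ≤ hKr := Nat.cast_nonneg _
  set Q : ℝ := ThornerZaman.condQn K with hQ
  have hQ12 : (12 : ℝ) ≤ Q := ThornerZaman.twelve_le_condQn (K := K) hK
  have hQ1 : (1 : ℝ) < Q := by linarith
  have hQ0 : (0 : ℝ) < Q := by linarith
  -- the collar ratio `ε₀ = e₀ Q^{-2}`
  have hQm2 : 0 < Q ^ (-(2 : ℝ)) := Real.rpow_pos_of_pos hQ0 _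
  have hQm2le : Q ^ (-(2 : ℝ)) ≤ 1 := Real.rpow_le_one_of_one_le_of_nonpos hQ1.le (by norm_num)
  set ε₀ : ℝ := e₀ * Q ^ (-(2 : ℝ)) with hε₀
  have hε₀0 : 0 < ε₀ := mul_pos he₀0 hQm2
  have hε₀Q : e₀ * ThornerZaman.condQn K ^ (-(2 : ℝ)) ≤ ε₀ := le_rfl
  have hε₀1 : ε₀ ≤ 1 / 4 := by
    have := mul_le_mul he₀1 hQm2le hQm2.le (by norm_num); rw [hε₀]; linarith
  have hc₁Q1 : c₁ * Q ^ (-(2 : ℝ)) ≤ 1 := (mul_le_mul hc₁1 hQm2le hQm2.le zero_le_one).trans (by norm_num)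
  have h24 : 24 * ε₀ ≤ κ / 4 * (c₁ * Q ^ (-(2 : ℝ))) := by
    rw [hε₀]; have := mul_le_mul_of_nonneg_right he₀κ hQm2.le; nlinarith
  -- the weight and the class sums in the weighted form of `window_sandwich`
  have hw0 : ∀ (C : ClassGroup (𝓞 K)) (I : Ideal (𝓞 K)), 0 ≤ classIndicatorIdeal K C I :=
    fun C I ↦ (classIndicatorIdeal_mem (K := K) C I).1
  -- the window data at `x ≥ Q^{a₁}`, `x^{1−δ} ≤ h ≤ x`
  have hxQ : Q ≤ x := by
    have : Q ^ (1 : ℝ) ≤ Q ^ a₁ := Real.rpow_le_rpow_of_exponent_le hQ1.le ha₁1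
    rw [Real.rpow_one] at this; linarith
  have hx1 : 1 < x := by linarith
  have hx0 : 0 < x := by linarith
  have hL0 : 0 < Real.log x := Real.log_pos hx1
  obtain ⟨-, -, hlog12⟩ := log_small_consts
  have hL16 : 2 ≤ Real.log x := hlog12.trans (Real.log_le_log (by norm_num) (hQ12.trans hxQ))
  have hδpos : 0 < x ^ (1 - δ) := Real.rpow_pos_of_pos hx0 _
  have hh0 : 0 < h := lt_of_lt_of_le hδpos hhx
  set t : ℝ := h / x with ht
  have ht0 : 0 < t := by positivity
  have ht1 : t ≤ 1 := by rw [ht, div_le_one hx0]; exact hhx'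
  have hxt : x * t = h := by rw [ht]; field_simp
  have hxh : x + h = x * (1 + t) := by rw [mul_add, mul_one, hxt]
  set η : ℝ := Real.log (1 + t) with hη
  have hη0 : 0 < η := Real.log_pos (by linarith)
  have hη1 : η ≤ Real.log 2 := Real.log_le_log (by linarith) (by linarith)
  have hηt' : η ≤ t := by
    have := Real.log_le_sub_one_of_pos (show (0 : ℝ) < 1 + t by linarith); rw [hη]; linarith
  have hlogxh : Real.log (x + h) = Real.log x + η := by
    rw [hxh, Real.log_mul hx0.ne' (by linarith), hη]
  have hηx : Real.exp (-(θ / 8) * Real.log x) ≤ 2 * η := by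
    have hηt : t / 2 ≤ η := by
      have h1 := Real.one_sub_inv_le_log_of_pos (show (0 : ℝ) < 1 + t by linarith)
      have h2 : t / 2 ≤ 1 - (1 + t)⁻¹ := by
        rw [show 1 - (1 + t)⁻¹ = t / (1 + t) by field_simp; ring]
        exact div_le_div_of_nonneg_left ht0.le (by linarith) (by linarith)
      linarith
    have h1 : Real.exp (-(θ / 8) * Real.log x) = x ^ (1 - θ / 8) / x := by
      rw [Real.rpow_def_of_pos hx0, eq_div_iff hx0.ne', ← Real.exp_log hx0, ← Real.exp_add, Real.exp_log hx0]
      congr 1; ring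
    rw [h1]
    have h2 : x ^ (1 - θ / 8) / x ≤ h / x := div_le_div_of_nonneg_right (by rw [← hδ]; exact hhx) hx0.le
    linarith
  have hxη : x * η ≤ h := by
    have := mul_le_mul_of_nonneg_left hηt' hx0.le; rw [hxt] at this; exact this
  have hexpη : Real.exp (Real.log x + η) = x + h := by
    rw [Real.exp_add, Real.exp_log hx0, hη, Real.exp_log (by linarith), hxh]
  have h2ε : 2 * (ε₀ * η) < η := by nlinarith
  have hε0 : 0 < ε₀ * η := by positivity
  -- conversion of the complex smoothed bounds into real form, in the weighted notation
  have hreal : ∀ (C : ClassGroup (𝓞 K)) (lo hi ε : ℝ) (cc : ℂ) (σ B : ℝ), 0 < ε → ε ≤ lo → lo ≤ hi →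
      ‖(NumberField.classNumber K : ℂ) * (smoothedPsiClass K C (windowTest lo hi ε) : ℂ) -
          fordLaplace (windowTest lo hi ε) (-1) + cc * fordLaplace (windowTest lo hi ε) (-(σ : ℂ))‖ ≤ B →
      hKr * (∑' k : ℕ, (∑ I ∈ idealsOfNorm K k, classIndicatorIdeal K C I * idealVonMangoldt I) *
          windowTest lo hi ε (Real.log k)) ≤
          (fordLaplace (windowTest lo hi ε) (-1)).re - cc.re * (fordLaplace (windowTest lo hi ε) (-(σ : ℂ))).re + B ∧
      (fordLaplace (windowTest lo hi ε) (-1)).re - cc.re * (fordLaplace (windowTest lo hi ε) (-(σ : ℂ))).re - B ≤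
        hKr * (∑' k : ℕ, (∑ I ∈ idealsOfNorm K k, classIndicatorIdeal K C I * idealVonMangoldt I) *
          windowTest lo hi ε (Real.log k)) := by
    intro C lo hi ε cc σ B hε0' hεlo hlohi hB
    have hS : (∑' k : ℕ, (∑ I ∈ idealsOfNorm K k, classIndicatorIdeal K C I * idealVonMangoldt I) *
        windowTest lo hi ε (Real.log k)) = smoothedPsiClass K C (windowTest lo hi ε) := rfl
    rw [hS]
    have h1 := (Complex.abs_re_le_norm _).trans hB
    have hFreal : (fordLaplace (windowTest lo hi ε) (-(σ : ℂ))).im = 0 :=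
      fordLaplace_windowTest_real_im hε0' (by linarith) σ
    simp only [Complex.add_re, Complex.sub_re, Complex.mul_re, Complex.natCast_re, Complex.natCast_im,
      Complex.ofReal_re, Complex.ofReal_im, mul_zero, sub_zero, hFreal] at h1
    rw [abs_le] at h1
    constructor <;> linarith [h1.1, h1.2]
  -- the unsmoothed class sum in the weighted notation
  have hψ : ∀ (C : ClassGroup (𝓞 K)) (y : ℝ),
      (∑ n ∈ Icc 0 ⌊y⌋₊, ∑ I ∈ idealsOfNorm K n, classIndicatorIdeal K C I * idealVonMangoldt I) = classPsi K C y :=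
    fun C y ↦ rfl
  refine ⟨fun hnoexc C ↦ ?_, fun χ₁ β₁ hreal' hLz hwin hβ1 C ↦ ?_⟩
  · -- (A): `rU = rD = 0`, `σ = 1`
    have hAup := hcaseA ε₀ hε₀Q hε₀1 x η hx hη0 hη1 hηx (Real.log x) (Real.log x + η) le_rfl (by linarith) le_rfl hnoexc C
    have hAlo := hcaseA ε₀ hε₀Q hε₀1 x η hx hη0 hη1 hηx (Real.log x + ε₀ * η) (Real.log x + η - ε₀ * η)
      (by linarith) (by linarith) (by linarith) hnoexc C
    have hup := (hreal C (Real.log x) (Real.log x + η) (ε₀ * η) 0 1 _ hε0 (by linarith) (by linarith) (by simpa using hAup)).1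
    have hlow := (hreal C (Real.log x + ε₀ * η) (Real.log x + η - ε₀ * η) (ε₀ * η) 0 1 _ hε0 (by linarith) (by linarith)
      (by simpa using hAlo)).2
    simp only [Complex.zero_re, zero_mul, sub_zero] at hup hlow
    have key := window_sandwich (hw0 C) hm0 (κ := κ / 4) (J := 0) hx1 hh0 hhx' hη0 hlogxh hxη hexpη hε₀0 hε₀1 h2ε
      hL16 hκ4 (rU := 0) (rD := 0) (σ := 1) (by norm_num) (by norm_num) (by norm_num) le_rfl
      (by simpa using hup) (by simpa using hlow)
    simp only [zero_mul, sub_zero, add_zero] at key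
    rw [hψ C, hψ C] at key
    have h24h : 24 * ε₀ * h ≤ κ / 4 * h := by
      have := mul_le_mul_of_nonneg_right (h24.trans (mul_le_mul_of_nonneg_left hc₁Q1 hκ4.le)) hh0.le
      nlinarith [mul_nonneg hκ4.le hh0.le]
    rw [abs_le]; constructor <;> linarith [key.1, key.2, h24h]
  · -- (B): coefficient `r = Re χ₁(C) ∈ {±1}`, `σ = β₁`, error `κ/4·μ`
    have hβhalf : 1 / 2 ≤ β₁ := half_le_of_window (N := K) (n₀ := n) hcn hwin
    set r : ℝ := (χ₁ C : ℂ).re with hr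
    have hr1 : |r| ≤ 1 := by
      refine (Complex.abs_re_le_norm _).trans ?_
      rw [norm_classGroupChar_apply]
    set μ : ℝ := min 1 ((1 - β₁) * Real.log x) with hμ
    have hμ0 : 0 < μ := lt_min one_pos (mul_pos (by linarith) (Real.log_pos hx1))
    have hκμ : 0 < κ / 4 * μ := mul_pos hκ4 hμ0
    have e1 : κ / 4 * x * η * μ = κ / 4 * μ * x * η := by ring
    have hBup := hcaseB ε₀ hε₀Q hε₀1 x η hx hη0 hη1 hηx (Real.log x) (Real.log x + η) le_rfl (by linarith) le_rfl χ₁ β₁ hreal' hLz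
      hwin hβ1 C
    have hBlo := hcaseB ε₀ hε₀Q hε₀1 x η hx hη0 hη1 hηx (Real.log x + ε₀ * η) (Real.log x + η - ε₀ * η) (by linarith) (by linarith)
      (by linarith) χ₁ β₁ hreal' hLz hwin hβ1 C
    rw [← hμ, e1] at hBup hBlo
    have hup := (hreal C (Real.log x) (Real.log x + η) (ε₀ * η) _ β₁ (κ / 4 * μ * x * η + 0) hε0 (by linarith)
      (by linarith) (by rw [add_zero]; exact hBup)).1
    have hlow := (hreal C (Real.log x + ε₀ * η) (Real.log x + η - ε₀ * η) (ε₀ * η) _ β₁ (κ / 4 * μ * x * η + 0) hε0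
      (by linarith) (by linarith) (by rw [add_zero]; exact hBlo)).2
    have key := window_sandwich (hw0 C) hm0 (κ := κ / 4 * μ) (J := 0) hx1 hh0 hhx' hη0 hlogxh hxη hexpη hε₀0 hε₀1
      h2ε hL16 hκμ (rU := r) (rD := r) (σ := β₁) hr1 hr1 hβhalf hβ1.le hup hlow
    have hmt : (Real.exp (β₁ * (Real.log x + η)) - Real.exp (β₁ * Real.log x)) / β₁ =
        ((x + h) ^ β₁ - x ^ β₁) / β₁ := by
      rw [Real.rpow_def_of_pos (by linarith : (0:ℝ) < x + h), Real.rpow_def_of_pos hx0, hlogxh]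
      ring_nf
    rw [hmt, add_zero, hψ C, hψ C] at key
    -- Stark: `c₁ Q^{-2} ≤ 1 − β₁ ≤ μ`
    have hδlow : c₁ * Q ^ (-(2 : ℝ)) ≤ 1 - β₁ := heff K hKn χ₁ hreal' β₁ hβ1 hLz
    have hμlow : c₁ * Q ^ (-(2 : ℝ)) ≤ μ := by
      refine le_min hc₁Q1 (hδlow.trans ?_)
      have := mul_le_mul_of_nonneg_left (show (1:ℝ) ≤ Real.log x by linarith) (by linarith : (0:ℝ) ≤ 1 - β₁)
      linarith
    have h24h : 24 * ε₀ * h ≤ κ / 4 * μ * h := by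
      have := mul_le_mul_of_nonneg_right (h24.trans (mul_le_mul_of_nonneg_left hμlow hκ4.le)) hh0.le; linarith
    have hκμh : 0 ≤ κ * μ * h := by positivity
    rw [abs_le]; constructor <;> linarith [key.1, key.2, h24h]

end Summit.QuantumAdvantage.QuantumAdvantage.Theorems.DegreeOnePrimesEscape

end
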